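import Literature.NumberTheory.LFunctions.MertensFirstVonMangoldtUpper
import HarnessLib

/-!
# Mertens' first theorem, lower half: `log N − 1 ≤ ∑_{n ≤ N} Λ(n)/n`, and the two-sided bound
# `|∑_{n ≤ x} Λ(n)/n − log x| ≤ 1 + log 2`

Topic `Literature/NumberTheory/LFunctions`. PROOF file (theorems only; no definition, no named fact),
the companion of `MertensFirstVonMangoldtUpper.lean` (`∑_{n ≤ x} Λ(n)/n ≤ log x + 39/50`). Proved from
Mathlib alone (sum–integral comparison, `∫ log`, Chebyshev's identity `Λ * ζ = log` as summed there):

* `integral_log_le_sum_log` — `N log N − N + 1 ≤ ∑_{1 ≤ m ≤ N} log m` (`N ≥ 1`; right Riemann sum of the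
  increasing function `log`, Hardy–Wright Theorem 423 with `h = 1`);
* `sum_log_le_mul_sum_vonMangoldt_div` — `∑_{m ≤ N} log m = ∑_{n ≤ N} Λ(n)⌊N/n⌋ ≤ N·∑_{n ≤ N} Λ(n)/n`;
* **`log_sub_one_le_sum_vonMangoldt_div`** — `log N − 1 + 1/N ≤ ∑_{n ≤ N} Λ(n)/n` for `N ≥ 1`, hence
  `log N − 1 ≤ ψ₁(N)` (Hardy–Wright Theorem 424, lower half, with the `O(1)` explicit);
* `log_sub_le_sum_vonMangoldt_div_floor` — real variable: `log x − (1 + log 2) ≤ ∑_{n ≤ x} Λ(n)/n` (`x ≥ 1`);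
* **`abs_sum_vonMangoldt_div_floor_sub_log_le`** — with the upper half: `|∑_{n ≤ x} Λ(n)/n − log x| ≤ 1 + log 2`
  for every real `x ≥ 1` (the true range is `(−0.753, 0]`, limit `−γ`; Rosser–Schoenfeld 1962 (3.21)–(3.22)).

The two-sided form is the Chebyshev-strength input `(M)` of Abel-summation arguments against `dM(t)`,
`M(t) = ∑_{n ≤ e^t} Λ(n)/n` (e.g. rh-explicit A6-PIVOT, CONTINUUM-LIMIT §25.3).

References: G. H. Hardy, E. M. Wright, *An Introduction to the Theory of Numbers*, 6th ed., §22.6,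
Theorems 423–424 [HardyWright2008]; F. Mertens, J. reine angew. Math. 78 (1874) 46–62.
-/

noncomputable section

open scoped Chebyshev
open ArithmeticFunction (vonMangoldt)

namespace Literature.NumberTheory.LFunctions.MertensFirstLower

/-- `N log N − N + 1 = ∫_1^N log t dt ≤ ∑_{1 ≤ m ≤ N} log m` for `N ≥ 1` (right Riemann sum of the increasing
function `log`). [cite: HardyWright2008, §22.6 Thm 423] -/
theorem integral_log_le_sum_log {N : ℕ} (hN : 1 ≤ N) :
    (N : ℝ) * Real.log N - N + 1 ≤ ∑ m ∈ Finset.Icc 1 N, Real.log m := by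
  have hmono : MonotoneOn Real.log (Set.Icc ((1 : ℕ) : ℝ) ((N : ℕ) : ℝ)) :=
    Real.strictMonoOn_log.monotoneOn.mono fun x hx ↦
      Set.mem_Ioi.2 (lt_of_lt_of_le (by norm_num) hx.1)
  have h := MonotoneOn.integral_le_sum_Ico hN hmono
  rw [integral_log] at h
  -- Σ_{i ∈ Ico 1 N} log (i+1) = Σ_{m ∈ Icc 2 N} log m ≤ Σ_{m ∈ Icc 1 N} log m (all terms are ≥ 0)
  have hshift : ∑ i ∈ Finset.Ico 1 N, Real.log ((i + 1 : ℕ) : ℝ) = ∑ m ∈ Finset.Icc 2 N, Real.log (m : ℝ) := by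
    refine Finset.sum_nbij' (fun i ↦ i + 1) (fun m ↦ m - 1) ?_ ?_ ?_ ?_ ?_
    · intro i hi; simp only [Finset.mem_Ico] at hi; simp only [Finset.mem_Icc]; omega
    · intro m hm; simp only [Finset.mem_Icc] at hm; simp only [Finset.mem_Ico]; omega
    · intro i hi; simp
    · intro m hm; simp only [Finset.mem_Icc] at hm; omega
    · intro i hi; rfl
  have hsub : ∑ m ∈ Finset.Icc 2 N, Real.log (m : ℝ) ≤ ∑ m ∈ Finset.Icc 1 N, Real.log (m : ℝ) :=
    Finset.sum_le_sum_of_subset_of_nonneg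
      (Finset.Icc_subset_Icc_left (by norm_num)) fun m hm _ ↦
        Real.log_nonneg (by exact_mod_cast (Finset.mem_Icc.1 hm).1)
  have hshift' : ∑ i ∈ Finset.Ico 1 N, Real.log ((i + 1 : ℕ) : ℝ) ≤ ∑ m ∈ Finset.Icc 1 N, Real.log (m : ℝ) :=
    hshift ▸ hsub
  push_cast at h hshift'
  have h1 : Real.log 1 = 0 := Real.log_one
  nlinarith [h, h1, hshift']

/-- `∑_{m ≤ N} log m ≤ N·∑_{n ≤ N} Λ(n)/n`: Chebyshev's identity `∑ Λ(n)⌊N/n⌋ = ∑ log m`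
(`MertensFirstUpper.sum_vonMangoldt_mul_div`) and `⌊N/n⌋ ≤ N/n`. [cite: HardyWright2008, §22.6 Thm 424] -/
theorem sum_log_le_mul_sum_vonMangoldt_div (N : ℕ) :
    ∑ m ∈ Finset.Icc 1 N, Real.log m ≤ (N : ℝ) * ∑ n ∈ Finset.Icc 1 N, vonMangoldt n / n := by
  rw [← MertensFirstUpper.sum_vonMangoldt_mul_div N, Finset.mul_sum]
  refine Finset.sum_le_sum fun n hn ↦ ?_
  have hn1 : (1 : ℝ) ≤ n := by exact_mod_cast (Finset.mem_Icc.1 hn).1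
  have hfl : ((N / n : ℕ) : ℝ) ≤ (N : ℝ) / n := Nat.cast_div_le
  calc vonMangoldt n * ((N / n : ℕ) : ℝ) ≤ vonMangoldt n * ((N : ℝ) / n) :=
        mul_le_mul_of_nonneg_left hfl ArithmeticFunction.vonMangoldt_nonneg
    _ = (N : ℝ) * (vonMangoldt n / n) := by ring

/-- **Mertens' first theorem, lower half** (Hardy–Wright Theorem 424 with the `O(1)` explicit):
`log N − 1 + 1/N ≤ ψ₁(N) = ∑_{n ≤ N} Λ(n)/n` for every natural `N ≥ 1`.
[cite: HardyWright2008, §22.6 Thm 424] -/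
theorem log_sub_one_le_sum_vonMangoldt_div {N : ℕ} (hN : 1 ≤ N) :
    Real.log N - 1 + 1 / N ≤ ∑ n ∈ Finset.Icc 1 N, vonMangoldt n / n := by
  have hN0 : (0 : ℝ) < N := by exact_mod_cast hN
  have h := (integral_log_le_sum_log hN).trans (sum_log_le_mul_sum_vonMangoldt_div N)
  -- divide by N
  have h' : (N : ℝ) * (Real.log N - 1 + 1 / N) ≤ N * ∑ n ∈ Finset.Icc 1 N, vonMangoldt n / n := by
    have : (N : ℝ) * (Real.log N - 1 + 1 / N) = N * Real.log N - N + 1 := by field_simp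
    rw [this]; exact h
  exact le_of_mul_le_mul_left h' hN0

/-- `log N − 1 ≤ ∑_{n ≤ N} Λ(n)/n` for `N ≥ 1`. [cite: HardyWright2008, §22.6 Thm 424] -/
theorem log_sub_one_le_sum_vonMangoldt_div' {N : ℕ} (hN : 1 ≤ N) :
    Real.log N - 1 ≤ ∑ n ∈ Finset.Icc 1 N, vonMangoldt n / n := by
  have h := log_sub_one_le_sum_vonMangoldt_div hN
  have : (0 : ℝ) ≤ 1 / N := by positivity
  linarith

/-- **Lower half, real variable**: for real `x ≥ 1`, `log x − (1 + log 2) ≤ ∑_{n ≤ x} Λ(n)/n` (the sum over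
`0 < n ≤ ⌊x⌋`; `log x ≤ log ⌊x⌋ + log 2` since `x < ⌊x⌋ + 1 ≤ 2⌊x⌋`). [cite: HardyWright2008, §22.6 Thm 424] -/
theorem log_sub_le_sum_vonMangoldt_div_floor {x : ℝ} (hx : 1 ≤ x) :
    Real.log x - (1 + Real.log 2) ≤ ∑ n ∈ Finset.Ioc 0 ⌊x⌋₊, vonMangoldt n / n := by
  have h1 : 1 ≤ ⌊x⌋₊ := Nat.le_floor (by exact_mod_cast hx)
  have hI : Finset.Ioc 0 ⌊x⌋₊ = Finset.Icc 1 ⌊x⌋₊ := by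
    ext n
    simp only [Finset.mem_Ioc, Finset.mem_Icc]
    omega
  rw [hI]
  have h := log_sub_one_le_sum_vonMangoldt_div' h1
  have hfl0 : (0 : ℝ) < (⌊x⌋₊ : ℕ) := by exact_mod_cast h1
  have hx2 : x ≤ 2 * (⌊x⌋₊ : ℕ) := by
    have := Nat.lt_floor_add_one x
    have h1' : (1 : ℝ) ≤ (⌊x⌋₊ : ℕ) := by exact_mod_cast h1
    linarith
  have hlog : Real.log x ≤ Real.log 2 + Real.log (⌊x⌋₊ : ℕ) := by
    rw [← Real.log_mul (by norm_num) hfl0.ne']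
    exact Real.log_le_log (by linarith) hx2
  linarith

/-- **Mertens' first theorem, two-sided, Chebyshev strength**: for every real `x ≥ 1`,
`|∑_{n ≤ x} Λ(n)/n − log x| ≤ 1 + log 2` (upper half `≤ 39/50` from `MertensFirstUpper`, lower half above; the
true range of the difference is `(−0.753, 0]` with limit `−γ`). [cite: HardyWright2008, §22.6 Thm 424] -/
theorem abs_sum_vonMangoldt_div_floor_sub_log_le {x : ℝ} (hx : 1 ≤ x) :
    |∑ n ∈ Finset.Ioc 0 ⌊x⌋₊, vonMangoldt n / n - Real.log x| ≤ 1 + Real.log 2 := by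
  have hup := MertensFirstUpper.sum_vonMangoldt_div_floor_le_log_add hx
  have hlo := log_sub_le_sum_vonMangoldt_div_floor hx
  have hlog2 : (0 : ℝ) < Real.log 2 := Real.log_pos (by norm_num)
  rw [abs_le]
  constructor <;> linarith

/-- **Lower half, real variable, `Icc` form**: for real `x ≥ 1`, `log x − (1 + log 2) ≤ ∑_{1 ≤ n ≤ ⌊x⌋} Λ(n)/n`
(the same sum written over `Finset.Icc 1 ⌊x⌋₊`, the indexing used by the partial-summation files downstream).
[cite: HardyWright2008, §22.6 Thm 424] -/
theorem log_sub_le_sum_vonMangoldt_div_Icc_floor {x : ℝ} (hx : 1 ≤ x) :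
    Real.log x - (1 + Real.log 2) ≤ ∑ n ∈ Finset.Icc 1 ⌊x⌋₊, vonMangoldt n / n := by
  have h := log_sub_le_sum_vonMangoldt_div_floor hx
  have hI : Finset.Ioc 0 ⌊x⌋₊ = Finset.Icc 1 ⌊x⌋₊ := by
    ext n; simp only [Finset.mem_Ioc, Finset.mem_Icc]; omega
  rwa [hI] at h

end Literature.NumberTheory.LFunctions.MertensFirstLower

end
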